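import Mathlib
import HarnessLib
import Summits.ValiantsHypothesis.ValiantsHypothesis.Theorems.LacunarySymmetroidMatrixDescartesProductPlusOneSignedTop
import Summits.ValiantsHypothesis.ValiantsHypothesis.Theorems.LacunarySymmetroidMatrixDescartesProductPlusOneTameKMembers

/-!
# ValiantsHypothesis / LacunarySymmetroid — crux `MatrixDescartes` (stmt-ValiantsHypothesis-18050, V1),
# LINE (A) «product_plus_one», member currency: the TAME SECTOR for every K at the TOP coupling, SIGN-AWARE (mirror)

* `member_top_eq_rev` — the ONE reversal lemma every top-coupling mirror needs, in member currency: for a strictly increasing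
  support `d`, the TOP-coupled member `C c·X^{m d_{K−1}} + ∏_j f_j` and the BOTTOM-coupled member of the reversed data
  `d' l = d_{K−1} − d_{K−1−l}`, `a' j l = a j (K−1−l)` have the same number of positive zeros (✓ `card_pos_roots_class_reverse` of
  ✓ `…TameReverse` + ✓ `member_reindex` with `Fin.revPerm`), and `d'` is again strictly increasing (`strictMono_rev_sub`).
* ★ `tameK_sector_classK_top_signed` — hypotheses of ✓ `eulerBound_tameK_top` VERBATIM (window `d_{K−1} − d_0 ≤ 4(d_{K−1} − d_{K−2})`, top
  coefficient nonzero, second-from-top free, lower coefficients weakly opposite to the top one), TOP coupling, every `K ≥ 2`: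
  `Z₊(C c·X^{m d_{K−1}} + ∏ f_j) ≤ #{j : ∃ l ≤ K−2, a_{j,K−1}·a_{jl} < 0} + 2` — the mirror of ✓ `tameK_sector_classK_signed` (val-lit-p7 g15,
  p674242; crit-1 g3 22:30:15Z: «TOP mirror left to p5 g14»);
* `classRowK3_tameWeakTop_signed` — the `K = 3` row at `l₀ = 2` in line shape.

HONEST FRAMING: bookkeeping corollaries (reversal + re-indexing); NOT `stub_classRowK3`, not `stub_polyLaw`, not `OneChangeFloorK3`, not
`ProductPlusOneMDR`, not `MatrixDescartes`, not Conjecture B; `VP ≠ VNP` is NOT proved.  No definitions, no named facts.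
-/

set_option linter.dupNamespace false

namespace Summit.ValiantsHypothesis.ValiantsHypothesis.Theorems.LacunarySymmetroidMatrixDescartes

namespace ProductPlusOne

open Polynomial Finset
open scoped BigOperators

/-! ### The reversal of a top-coupled member (general `K`) -/

/-- The reversed support `l ↦ d_{K−1} − d_{K−1−l}` of a strictly increasing support is strictly increasing. [folklore] -/
theorem strictMono_rev_sub {K : ℕ} (hK : 1 ≤ K) (d : Fin K → ℕ) (hd : StrictMono d) :
    StrictMono (fun l : Fin K => d ⟨K - 1, by omega⟩ - d (Fin.rev l)) := by
  intro i j hij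
  have h1 : Fin.rev j < Fin.rev i := Fin.rev_lt_rev.mpr hij
  have h2 : d (Fin.rev j) < d (Fin.rev i) := hd h1
  have h3 : d (Fin.rev i) ≤ d ⟨K - 1, by omega⟩ :=
    hd.monotone (Fin.mk_le_mk.mpr (by have := (Fin.rev i).isLt; omega) : Fin.rev i ≤ ⟨K - 1, by omega⟩)
  show d ⟨K - 1, by omega⟩ - d (Fin.rev i) < d ⟨K - 1, by omega⟩ - d (Fin.rev j)
  omega

/-- **Reversal of a TOP-coupled member** (`x ↦ 1/x` plus the letter re-indexing `l ↦ K−1−l`): the member coupled at the top letter of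
`d` has exactly as many positive zeros as the member of the reversed data coupled at ITS bottom letter. [folklore] -/
theorem member_top_eq_rev {m K : ℕ} (hK : 1 ≤ K) (d : Fin K → ℕ) (hd : StrictMono d) (a : Fin m → Fin K → ℝ) (c : ℝ) :
    ((C c * X ^ (m * d ⟨K - 1, by omega⟩) + ∏ j, ∑ l, C (a j l) * X ^ (d l) : ℝ[X]).roots.toFinset.filter (fun t => 0 < t)).card
      = ((C c * X ^ (m * (fun l : Fin K => d ⟨K - 1, by omega⟩ - d (Fin.rev l)) ⟨0, by omega⟩)
          + ∏ j, ∑ l, C ((fun j (l : Fin K) => a j (Fin.rev l)) j l)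
              * X ^ ((fun l : Fin K => d ⟨K - 1, by omega⟩ - d (Fin.rev l)) l) : ℝ[X]).roots.toFinset.filter
          (fun t => 0 < t)).card := by
  classical
  set top : Fin K := ⟨K - 1, by omega⟩ with htop
  set D : ℕ := d top with hDdef
  have hD : ∀ l, d l ≤ D := fun l => hd.monotone (Fin.mk_le_mk.mpr (by have := l.isLt; omega) : l ≤ top)
  rw [← card_pos_roots_class_reverse d D hD a top c]
  have hrev0 : Fin.rev (⟨0, by omega⟩ : Fin K) = top := by
    rw [htop]; ext; simp only [Fin.val_rev]
  have h0 : D - d (Fin.rev (⟨0, by omega⟩ : Fin K)) = D - d top := by rw [hrev0]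
  simp only [h0]
  have hre : (C c * X ^ (m * (D - d top)) + ∏ j, ∑ l, C (a j (Fin.rev l)) * X ^ (D - d (Fin.rev l)) : ℝ[X])
      = C c * X ^ (m * (D - d top)) + ∏ j, ∑ l, C (a j l) * X ^ (D - d l) := by
    have := member_reindex Fin.revPerm (fun l => D - d l) a (m * (D - d top)) c
    simpa only [Fin.revPerm_apply] using this
  rw [hre]

/-! ### The tame sector at the top coupling, sign-aware -/

/-- ★ **THE TAME SECTOR AT THE TOP COUPLING, SIGN-AWARE member count, EVERY FORMAT** (hypotheses of ✓ `eulerBound_tameK_top`):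
`Z₊(C c·X^{m d_{K−1}} + ∏ f_j) ≤ #{j : ∃ l ≤ K−2, a_{j,K−1}·a_{jl} < 0} + 2`.  Mirror of ✓ `tameK_sector_classK_signed`. [this file's theorem] -/
theorem tameK_sector_classK_top_signed {m K : ℕ} (hK : 2 ≤ K) (d : Fin K → ℕ) (hd : StrictMono d)
    (hwin : d ⟨K - 1, by omega⟩ - d ⟨0, by omega⟩ ≤ 4 * (d ⟨K - 1, by omega⟩ - d ⟨K - 2, by omega⟩)) (a : Fin m → Fin K → ℝ)
    (ht : ∀ j, (0 < a j ⟨K - 1, by omega⟩ ∧ ∀ l : Fin K, (l : ℕ) + 3 ≤ K → a j l ≤ 0) ∨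
      (a j ⟨K - 1, by omega⟩ < 0 ∧ ∀ l : Fin K, (l : ℕ) + 3 ≤ K → 0 ≤ a j l)) (c : ℝ) :
    ((C c * X ^ (m * d ⟨K - 1, by omega⟩) + ∏ j, ∑ l, C (a j l) * X ^ (d l) : ℝ[X]).roots.toFinset.filter (fun t => 0 < t)).card
      ≤ (Finset.univ.filter (fun j => ∃ l : Fin K, (l : ℕ) + 2 ≤ K ∧ a j ⟨K - 1, by omega⟩ * a j l < 0)).card + 2 := by
  classical
  rw [member_top_eq_rev (by omega) d hd a c]
  set d' : Fin K → ℕ := fun l => d ⟨K - 1, by omega⟩ - d (Fin.rev l) with hd'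
  set a' : Fin m → Fin K → ℝ := fun j l => a j (Fin.rev l) with ha'
  have hd'mono : StrictMono d' := strictMono_rev_sub (by omega) d hd
  have hrev0 : Fin.rev (⟨0, by omega⟩ : Fin K) = ⟨K - 1, by omega⟩ := by ext; simp only [Fin.val_rev]
  have hrev1 : Fin.rev (⟨1, by omega⟩ : Fin K) = ⟨K - 2, by omega⟩ := by ext; simp only [Fin.val_rev]
  have hrevK : Fin.rev (⟨K - 1, by omega⟩ : Fin K) = ⟨0, by omega⟩ := by ext; simp only [Fin.val_rev]; omega
  have hwin' : d' ⟨K - 1, by omega⟩ - d' ⟨0, by omega⟩ ≤ 4 * (d' ⟨1, by omega⟩ - d' ⟨0, by omega⟩) := by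
    have vK : d' ⟨K - 1, by omega⟩ = d ⟨K - 1, by omega⟩ - d ⟨0, by omega⟩ := by
      show d ⟨K - 1, by omega⟩ - d (Fin.rev ⟨K - 1, by omega⟩) = _; rw [hrevK]
    have v0 : d' ⟨0, by omega⟩ = 0 := by
      show d ⟨K - 1, by omega⟩ - d (Fin.rev ⟨0, by omega⟩) = 0; rw [hrev0]; exact Nat.sub_self _
    have v1 : d' ⟨1, by omega⟩ = d ⟨K - 1, by omega⟩ - d ⟨K - 2, by omega⟩ := by
      show d ⟨K - 1, by omega⟩ - d (Fin.rev ⟨1, by omega⟩) = _; rw [hrev1]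
    rw [vK, v0, v1, Nat.sub_zero, Nat.sub_zero]
    exact hwin
  have ht' : ∀ j, (0 < a' j ⟨0, by omega⟩ ∧ ∀ l : Fin K, 2 ≤ (l : ℕ) → a' j l ≤ 0) ∨
      (a' j ⟨0, by omega⟩ < 0 ∧ ∀ l : Fin K, 2 ≤ (l : ℕ) → 0 ≤ a' j l) := by
    intro j
    rcases ht j with ⟨h0, h⟩ | ⟨h0, h⟩
    · refine Or.inl ⟨by simp only [ha']; rw [hrev0]; exact h0, fun l hl => ?_⟩
      simp only [ha']
      exact h (Fin.rev l) (by simp only [Fin.val_rev]; omega)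
    · refine Or.inr ⟨by simp only [ha']; rw [hrev0]; exact h0, fun l hl => ?_⟩
      simp only [ha']
      exact h (Fin.rev l) (by simp only [Fin.val_rev]; omega)
  refine (tameK_sector_classK_signed hK d' hd'mono hwin' a' ht' c).trans (le_of_eq ?_)
  congr 2
  refine Finset.filter_congr fun j _ => ?_
  simp only [ha']
  rw [hrev0]
  constructor
  · rintro ⟨l, hl, h⟩
    exact ⟨Fin.rev l, by simp only [Fin.val_rev]; omega, h⟩
  · rintro ⟨l, hl, h⟩
    exact ⟨Fin.rev l, by simp only [Fin.val_rev]; omega, by rw [Fin.rev_rev]; exact h⟩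

/-- **The `K = 3` row at the TOP coupling, weak tame hypotheses, sign-aware** (`d 0 < d 1 < d 2`, `d 2 − d 0 ≤ 4(d 2 − d 1)`; `a_{j2} ≠ 0`,
`a_{j0}` weakly opposite in sign, `a_{j1}` free): `Z₊(C c·X^{m d 2} + ∏ f_j) ≤ #{j : a_{j2} a_{j1} < 0 ∨ a_{j2} a_{j0} < 0} + 2`.
[this file's theorem] -/
theorem classRowK3_tameWeakTop_signed {m : ℕ} (d : Fin 3 → ℕ) (h01 : d 0 < d 1) (h12 : d 1 < d 2)
    (hwin : d 2 - d 0 ≤ 4 * (d 2 - d 1)) (a : Fin m → Fin 3 → ℝ)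
    (ht : ∀ j, (0 < a j 2 ∧ a j 0 ≤ 0) ∨ (a j 2 < 0 ∧ 0 ≤ a j 0)) (c : ℝ) :
    ((C c * X ^ (m * d 2) + ∏ j, ∑ l, C (a j l) * X ^ (d l) : ℝ[X]).roots.toFinset.filter (fun t => 0 < t)).card
      ≤ (Finset.univ.filter (fun j => a j 2 * a j 1 < 0 ∨ a j 2 * a j 0 < 0)).card + 2 := by
  classical
  have hd : StrictMono d := Fin.strictMono_iff_lt_succ.2 fun i => by fin_cases i <;> assumption
  have ht' : ∀ j, (0 < a j 2 ∧ ∀ l : Fin 3, (l : ℕ) + 3 ≤ 3 → a j l ≤ 0) ∨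
      (a j 2 < 0 ∧ ∀ l : Fin 3, (l : ℕ) + 3 ≤ 3 → 0 ≤ a j l) := by
    intro j
    rcases ht j with ⟨h2, h0⟩ | ⟨h2, h0⟩
    · exact Or.inl ⟨h2, fun l hl => by fin_cases l <;> simp at hl; exact h0⟩
    · exact Or.inr ⟨h2, fun l hl => by fin_cases l <;> simp at hl; exact h0⟩
  refine (tameK_sector_classK_top_signed (by norm_num) d hd hwin a ht' c).trans (le_of_eq ?_)
  congr 2
  refine Finset.filter_congr fun j _ => ?_
  constructor
  · rintro ⟨l, hl, h⟩
    fin_cases l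
    · exact Or.inr h
    · exact Or.inl h
    · simp at hl
  · rintro (h | h)
    · exact ⟨1, by simp, h⟩
    · exact ⟨0, by simp, h⟩

end ProductPlusOne

end Summit.ValiantsHypothesis.ValiantsHypothesis.Theorems.LacunarySymmetroidMatrixDescartes
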